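import Summits.CriticalPhenomena.CardyFormulaZ2.Theses.CardyUSTContinuation
import Summits.CriticalPhenomena.CardyFormulaZ2.Theorems.CardyUSTContinuationKirchhoffExtremalLengthSlope
import Summits.CriticalPhenomena.CardyFormulaZ2.Theorems.CardyUSTContinuationKirchhoffExtremalLengthModulus

/-!
# `KirchhoffExtremalLength` reduced to the convergence of the Kirchhoff slope

Support file for `KirchhoffExtremalLength` (route CardyUSTContinuation of `CardyFormulaZ2`,
item stmt-CriticalPhenomena-11234). The item is `∃ s, (∀ᶠ δ, u_R(t,δ)/t → s δ) ∧
R.HasCrossingLimit s (η ↦ ₂F₁(½,½;1;η)/₂F₁(½,½;1;1-η))`. With the slope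
`s(δ) = [t^{m+1}] N_δ / [t^m] Z^joint_δ` of `…Slope.lean` (conjunct 1, proved) and the
identification `₂F₁(½,½;1;η)/₂F₁(½,½;1;1-η) = d_Ω((ab),(cd))⁻¹` for every uniformizing datum
(`…Modulus.lean`, proved), the item follows from — and, the slope being determined, is
equivalent to — the convergence of `s(δ)` to the reciprocal extremal distance as `δ → 0⁺`
(`kirchhoffExtremalLength_of_slope_tendsto`). The companion file `…Reduction.lean` rewrites the
slope as the effective conductance between the discrete arcs (Kirchhoff's theorem), leaving the
G02-discretisation analogue of [GP19] Cor. 4.15 as the one remaining input.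
-/

noncomputable section

namespace Summit.CriticalPhenomena.CardyFormulaZ2.Theorems

namespace KirchhoffSlope

open Filter Topology Polynomial
open Literature.Probability.LatticeModels Literature.Probability.Percolation
open Literature.Probability.RandomPlanarGeometry

/-- **`KirchhoffExtremalLength` follows from the convergence of the Kirchhoff slope to the
reciprocal extremal distance.** If for every conformal rectangle the slope
`s(δ) = [t^{m+1}] N_δ / [t^m] Z^joint_δ` (`m = ord₀ Z^joint_δ`) of the jointly-wired self-dual FK
crossing probability tends, as `δ → 0⁺`, to `d_Ω((ab),(cd))⁻¹`, then `KirchhoffExtremalLength`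
holds: conjunct 1 is `eventually_tendsto_crossingProb_div`, and the crossing limit is the
hypothesis rewritten through `toReal_inv_extremalDistance_arc_eq`. [folklore] -/
theorem kirchhoffExtremalLength_of_slope_tendsto
    (H : ∀ R : ConformalRectangle, Tendsto (fun δ : ℝ =>
      ((fkTwoArcCrossingPolynomial R δ .joint).coeff
          ((fkTwoArcPartitionPolynomials R δ .joint).natTrailingDegree + 1) : ℝ) /
        ((fkTwoArcPartitionPolynomials R δ .joint).coeff
          (fkTwoArcPartitionPolynomials R δ .joint).natTrailingDegree : ℝ))
      (𝓝[>] 0)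
      (𝓝 ((Literature.Analysis.Complex.extremalDistance R.carrier (R.arc 0) (R.arc 2))⁻¹).toReal)) :
    Summit.CriticalPhenomena.CardyFormulaZ2.Theses.CardyUSTContinuation.KirchhoffExtremalLength := by
  intro R
  refine ⟨fun δ => ((fkTwoArcCrossingPolynomial R δ .joint).coeff
          ((fkTwoArcPartitionPolynomials R δ .joint).natTrailingDegree + 1) : ℝ) /
        ((fkTwoArcPartitionPolynomials R δ .joint).coeff
          (fkTwoArcPartitionPolynomials R δ .joint).natTrailingDegree : ℝ),
    eventually_tendsto_crossingProb_div R, fun φ x hφx => ?_⟩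
  show Tendsto _ _ (𝓝 (ordinaryHypergeometric (1 / 2 : ℝ) (1 / 2) 1 (crossRatio x) /
    ordinaryHypergeometric (1 / 2 : ℝ) (1 / 2) 1 (1 - crossRatio x)))
  rw [← ModulusIdentification.toReal_inv_extremalDistance_arc_eq R hφx]
  exact H R

end KirchhoffSlope

end Summit.CriticalPhenomena.CardyFormulaZ2.Theorems
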